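import Summits.Ventures.Crystal3D.Bulk.TwinJunctionWitness
import Literature.Geometry.DiscreteGeometry.LayerShellPatterns
import Mathlib.Analysis.Normed.Affine.MazurUlam
import HarnessLib

/-!
# The twin junction lies in no Barlow stacking (W-2G refuted in the kernel) — ADD-ON to
`Bulk/TwinJunctionWitness.lean`

HONEST FRAMING. Part of the venture `Summits/Ventures/Crystal3D` (cell `pub-crystal3d`, phase 2;
mathematics and Lean text by seat theory-2 (g8)). A NEGATIVE / scope file for the fixed theorem
wording (GLUE-STATUS.md §3): it certifies nothing about `−0.63`, moves no number, and is not used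
by `BulkCrystallization3D`. It is Part B of theory-2's monolithic scratch `SmallTwinWitness.lean`
(HOME/lean/glue/, farm rc 0 / std 3), split off so that it IMPORTS the filed Part A
(`Bulk/TwinJunctionWitness.lean`: the 26-ball packing `twinConfig`, its three close-packed shells,
the cluster `twinCluster = {0,1,2}`, `not_isUniaxial_twinConfig`).

WHAT IT PROVES. **`not_isBarlowFragmentOn_twinConfig`**: NO isometry of `ℝ³` carries the closed
contact neighbourhood of `twinCluster` (all 26 balls) into ONE Barlow stacking
`barlowStacking 1 √(2/3) σ` (`Literature/…/BarlowStacking.lean`; any Hägg word `σ`). Mechanism,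
all over tree objects: the Mazur–Ulam linear part `L` of the isometry; the tree's
`kissingShell_barlowStacking_subset_layerShell` puts `L '' (contact shell)` inside a
`layerShell α β` (`α, β = ±1`); `apply_two_eq_zero_of_neg_mem_layerShell`: antipodal vectors
`z, −z` of a layer shell are horizontal unless `β = −α` (fcc-type site), and
`neg_mem_layerShell_fcc`: fcc-type layer shells are centrally symmetric — an anticuboctahedron is
not (twelve points each, so inclusion is equality); hence the hexagon planes of BOTH hcp-shelled
balls `0` (normal `(1,1,1)`) and `2` (normal `(1,1,−1)`) would go to the horizontal plane, i.e.
`L(ℝ³) ⊂` a plane — absurd (`false_of_apply_two_eq_zero`). Consequences: **`smallTwinWitness :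
SmallTwinWitness`** and **`not_naiveGrainRigidity : ¬ NaiveGrainRigidity`**, with
`IsBarlowFragmentOn` / `withNeighbors` / `NaiveGrainRigidity` / `SmallTwinWitness` the same text as
theory-2's statement file `GrainAxesStatements.lean`. Standard three axioms throughout.

MEANING for the wording (GLUE-STATUS §3 W-2G): the naive grain lemma («a contact-connected cluster
of close-packed-shelled balls lies, with its neighbours, in one Barlow stacking») is FALSE; the
bulk theorem carries no «⊂ one Barlow packing / bounded number of grains» clause on the strength
of close-packed shells; W-2a (`FccGrainRigidity`) and W-2b (`UniaxialGrainRigidity`) remain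
believed true and unproved.
-/

noncomputable section

open scoped BigOperators InnerProductSpace
open Finset

namespace Summit.Ventures.Crystal3D

open Literature.Geometry.DiscreteGeometry (fccKissingPattern hcpKissingPattern fccInt hcpInt intVec
  intVec_apply intVec_sub intVec_injective sqNormInt scaledPattern IsArrangedIn isArrangedIn_self)
open Literature.Barriers.AtomisticToContinuum (intConfig)

variable {N : ℕ}

/-! ## Part B — no single Barlow stacking contains the junction (`¬ NaiveGrainRigidity`) -/

section PartB

open Literature.MathematicalPhysics.StatisticalMechanics (barlowStacking barlowPos IsHaggSeq
  barlowPos_mem layerNormal)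
open Literature.Geometry.DiscreteGeometry (layerSpacing layerShell hexagonSet holeTriple
  kissingShell layerSpacing_pos kissingShell_barlowStacking_subset_layerShell mem_layerShell_iff
  apply_two_of_mem_hexagonSet apply_two_of_mem_holeTriple neg_mem_holeTriple_iff
  mem_holeTriple_iff mem_holeTriple_one_iff ncard_layerShell_le finite_layerShell card_hcpInt)

/-- The balls indexed by `S` form a fragment of ONE Barlow stacking (touching spacings `a = 1`,
`h = √(2/3)`), up to an isometry of `ℝ³` (same text as `GrainAxesStatements.lean`). -/
def IsBarlowFragmentOn (x : Fin N → EuclideanSpace ℝ (Fin 3)) (S : Finset (Fin N)) : Prop :=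
  ∃ σ : ℤ → ℤ, IsHaggSeq σ ∧
    ∃ g : EuclideanSpace ℝ (Fin 3) ≃ᵢ EuclideanSpace ℝ (Fin 3),
      ∀ i ∈ S, g (x i) ∈ barlowStacking 1 (Real.sqrt (2 / 3)) σ

/-- `G` together with all contact neighbours of its members. -/
def withNeighbors (x : Fin N → EuclideanSpace ℝ (Fin 3)) (G : Finset (Fin N)) :
    Finset (Fin N) :=
  G ∪ G.biUnion fun i => contactNeighbors x i

/-- **W-2G, the naive grain lemma** (FALSE, `not_naiveGrainRigidity` below): a non-empty
contact-connected cluster of close-packed-shelled balls lies, with its contact neighbours, in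
one Barlow stacking. -/
def NaiveGrainRigidity : Prop :=
  ∀ (N : ℕ) (x : Fin N → EuclideanSpace ℝ (Fin 3)), IsUnitPacking x →
    ∀ G : Finset (Fin N), G.Nonempty → IsContactConnected x G →
      (∀ i ∈ G, IsClosePackedShell x i) → IsBarlowFragmentOn x (withNeighbors x G)

/-- **The small twin witness** (statement as in `GrainAxesStatements.lean`). -/
def SmallTwinWitness : Prop :=
  ∃ (N : ℕ) (x : Fin N → EuclideanSpace ℝ (Fin 3)) (G : Finset (Fin N)),
    IsUnitPacking x ∧ G.Nonempty ∧ IsContactConnected x G ∧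
      (∀ i ∈ G, IsClosePackedShell x i) ∧ ¬ IsBarlowFragmentOn x (withNeighbors x G)

/-- Logic only: the small witness refutes the naive grain lemma. -/
theorem not_naiveGrainRigidity_of_smallTwinWitness (h : SmallTwinWitness) :
    ¬ NaiveGrainRigidity := by
  obtain ⟨N, x, G, hx, hne, hconn, hcp, hnot⟩ := h
  exact fun hnaive => hnot (hnaive N x hx G hne hconn hcp)

/-! ### Layer-shell geometry -/

/-- Touching spacings `(1, √(2/3))` doubled are Hales's `(2, 𝗁)`. -/
theorem two_smul_barlowPos (σ : ℤ → ℤ) (k i j : ℤ) :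
    (2 : ℝ) • barlowPos 1 (Real.sqrt (2 / 3)) σ k i j = barlowPos 2 layerSpacing σ k i j := by
  ext m
  fin_cases m <;> simp [layerSpacing] <;> ring

/-- Second coordinates inside the basic hole triple, times `√3`: `1, 1, −2`. -/
theorem holeTriple_one_apply_one {t : EuclideanSpace ℝ (Fin 3)} (ht : t ∈ holeTriple 1) :
    t 1 * Real.sqrt 3 = 1 ∨ t 1 * Real.sqrt 3 = -2 := by
  have h3 : Real.sqrt 3 ^ 2 = 3 := Real.sq_sqrt (by norm_num)
  rw [mem_holeTriple_one_iff] at ht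
  rcases ht with rfl | rfl | rfl
  · left; simp; linear_combination (1 / 3 : ℝ) * h3
  · left; simp; linear_combination (1 / 3 : ℝ) * h3
  · right; simp; linear_combination (1 / 3 - 1 : ℝ) * h3

/-- The hole triples of opposite type are disjoint. -/
theorem false_of_mem_holeTriple_one_neg_one {t : EuclideanSpace ℝ (Fin 3)}
    (ht : t ∈ holeTriple 1) (ht' : t ∈ holeTriple (-1)) : False := by
  have h1 := holeTriple_one_apply_one ht
  rw [mem_holeTriple_iff] at ht'
  obtain ⟨t₀, ht₀, rfl⟩ := ht'
  have h2 := holeTriple_one_apply_one ht₀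
  simp only [PiLp.smul_apply, smul_eq_mul, neg_mul, one_mul] at h1
  rcases h1 with h1 | h1 <;> rcases h2 with h2 | h2 <;> linarith

/-- Two hole triples sharing a point have the same type (`σ, τ = ±1`). -/
theorem eq_of_mem_holeTriple {σ τ : ℝ} (hσ : σ = 1 ∨ σ = -1) (hτ : τ = 1 ∨ τ = -1)
    {t : EuclideanSpace ℝ (Fin 3)} (h₁ : t ∈ holeTriple σ) (h₂ : t ∈ holeTriple τ) : σ = τ := by
  rcases hσ with rfl | rfl <;> rcases hτ with rfl | rfl
  · rfl
  · exact (false_of_mem_holeTriple_one_neg_one h₁ h₂).elim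
  · exact (false_of_mem_holeTriple_one_neg_one h₂ h₁).elim
  · rfl

/-- **Antipodal shell vectors of a layer shell are horizontal, except at fcc-type sites.** -/
theorem apply_two_eq_zero_of_neg_mem_layerShell {α β : ℝ} (hα : α = 1 ∨ α = -1)
    (hβ : β = 1 ∨ β = -1) {z : EuclideanSpace ℝ (Fin 3)} (hz : z ∈ layerShell α β)
    (hnz : -z ∈ layerShell α β) : z 2 = 0 ∨ β = -α := by
  have hnα : -α = 1 ∨ -α = -1 := by rcases hα with rfl | rfl <;> norm_num
  have hnβ : -β = 1 ∨ -β = -1 := by rcases hβ with rfl | rfl <;> norm_num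
  rw [mem_layerShell_iff] at hz hnz
  rcases hz with hz | hz | hz
  · exact Or.inl (apply_two_of_mem_hexagonSet hz)
  · -- `z` is an upper cap vector: `z 2 = 𝗁`
    have hz2 : z 2 = layerSpacing := by
      have := apply_two_of_mem_holeTriple hz
      simp at this; linarith
    rcases hnz with hnz | hnz | hnz
    · left; have := apply_two_of_mem_hexagonSet hnz; simpa using this
    · exfalso
      have := apply_two_of_mem_holeTriple hnz
      simp at this; linarith [layerSpacing_pos]
    · right
      have h' : z - layerNormal layerSpacing ∈ holeTriple (-β) := by
        rw [← neg_mem_holeTriple_iff]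
        have : -(z - layerNormal layerSpacing) = -z + layerNormal layerSpacing := by abel
        rw [this]; exact hnz
      have := eq_of_mem_holeTriple hα hnβ hz h'
      linarith
  · -- `z` is a lower cap vector: `z 2 = -𝗁`
    have hz2 : z 2 = -layerSpacing := by
      have := apply_two_of_mem_holeTriple hz
      simp at this; linarith
    rcases hnz with hnz | hnz | hnz
    · left; have := apply_two_of_mem_hexagonSet hnz; simpa using this
    · right
      have h' : z + layerNormal layerSpacing ∈ holeTriple (-α) := by
        rw [← neg_mem_holeTriple_iff]
        have : -(z + layerNormal layerSpacing) = -z - layerNormal layerSpacing := by abel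
        rw [this]; exact hnz
      have := eq_of_mem_holeTriple hβ hnα hz h'
      linarith
    · exfalso
      have := apply_two_of_mem_holeTriple hnz
      simp at this; linarith [layerSpacing_pos]

/-- The hexagon is centrally symmetric. -/
theorem neg_mem_hexagonSet {z : EuclideanSpace ℝ (Fin 3)} (hz : z ∈ hexagonSet) :
    -z ∈ hexagonSet := by
  simp only [hexagonSet, Set.mem_insert_iff, Set.mem_singleton_iff] at hz ⊢
  rcases hz with rfl | rfl | rfl | rfl | rfl | rfl <;> simp [neg_sub]

/-- **An fcc-type layer shell (cuboctahedron) is centrally symmetric.** -/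
theorem neg_mem_layerShell_fcc {α : ℝ} {z : EuclideanSpace ℝ (Fin 3)}
    (hz : z ∈ layerShell α (-α)) : -z ∈ layerShell α (-α) := by
  rw [mem_layerShell_iff] at hz ⊢
  rcases hz with hz | hz | hz
  · exact Or.inl (neg_mem_hexagonSet hz)
  · right; right
    have : -z + layerNormal layerSpacing = -(z - layerNormal layerSpacing) := by abel
    rw [this, neg_mem_holeTriple_iff, neg_neg]
    exact hz
  · right; left
    have : -z - layerNormal layerSpacing = -(z + layerNormal layerSpacing) := by abel
    rw [this, neg_mem_holeTriple_iff]
    exact hz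

/-- **Shell lemma.** If a linear isometry carries a twelve-point, NOT centrally symmetric shell
`S` into a layer shell, then it lays every antipodal pair `s, −s ∈ S` horizontal. -/
theorem apply_two_eq_zero_of_shell {S : Set (EuclideanSpace ℝ (Fin 3))}
    (L : EuclideanSpace ℝ (Fin 3) ≃ₗᵢ[ℝ] EuclideanSpace ℝ (Fin 3)) {α β : ℝ}
    (hα : α = 1 ∨ α = -1) (hβ : β = 1 ∨ β = -1)
    (hsub : (L : EuclideanSpace ℝ (Fin 3) → EuclideanSpace ℝ (Fin 3)) '' S ⊆ layerShell α β)
    (hcard : S.ncard = 12) (hnsym : ∃ s ∈ S, -s ∉ S)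
    {s : EuclideanSpace ℝ (Fin 3)} (hs : s ∈ S) (hns : -s ∈ S) : (L s) 2 = 0 := by
  rcases apply_two_eq_zero_of_neg_mem_layerShell hα hβ (hsub ⟨s, hs, rfl⟩)
      (by rw [← map_neg]; exact hsub ⟨-s, hns, rfl⟩) with h | h
  · exact h
  · exfalso
    subst h
    have heq : (L : EuclideanSpace ℝ (Fin 3) → EuclideanSpace ℝ (Fin 3)) '' S =
        layerShell α (-α) :=
      Set.eq_of_subset_of_ncard_le hsub
        (by rw [Set.ncard_image_of_injective _ L.injective, hcard]; exact ncard_layerShell_le _ _)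
        (finite_layerShell _ _)
    obtain ⟨s₀, hs₀, hns₀⟩ := hnsym
    have h1 : -(L s₀) ∈ (L : EuclideanSpace ℝ (Fin 3) → EuclideanSpace ℝ (Fin 3)) '' S := by
      rw [heq]; exact neg_mem_layerShell_fcc (heq ▸ ⟨s₀, hs₀, rfl⟩)
    obtain ⟨s₁, hs₁, he⟩ := h1
    have : s₁ = -s₀ := L.injective (by rw [he, map_neg])
    exact hns₀ (this ▸ hs₁)

/-- **Fragment lemma.** In a fragment of one Barlow stacking, the linear part of the placing
isometry carries the contact shell of every interior ball INTO a layer shell `layerShell α β`,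
`α, β = ±1`. -/
theorem image_contactShell_subset_layerShell {x : Fin N → EuclideanSpace ℝ (Fin 3)}
    {S : Finset (Fin N)} {i : Fin N} {σ : ℤ → ℤ} (hσ : IsHaggSeq σ)
    (g : EuclideanSpace ℝ (Fin 3) ≃ᵢ EuclideanSpace ℝ (Fin 3))
    (hg : ∀ j ∈ S, g (x j) ∈ barlowStacking 1 (Real.sqrt (2 / 3)) σ)
    (hi : i ∈ S) (hnb : ∀ j ∈ contactNeighbors x i, j ∈ S) :
    ∃ α β : ℝ, (α = 1 ∨ α = -1) ∧ (β = 1 ∨ β = -1) ∧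
      (g.toRealAffineIsometryEquiv.linearIsometryEquiv :
          EuclideanSpace ℝ (Fin 3) → EuclideanSpace ℝ (Fin 3)) '' contactShell x i ⊆
        layerShell α β := by
  obtain ⟨k, a, b, hk⟩ := hg i hi
  refine ⟨(σ k : ℝ), -(σ (k - 1) : ℝ), by exact_mod_cast hσ k, ?_, ?_⟩
  · rcases hσ (k - 1) with h | h <;> simp [h]
  · rintro _ ⟨s, hs, rfl⟩
    obtain ⟨j, hj, rfl⟩ := hs
    have hj' : j ∈ contactNeighbors x i := by exact_mod_cast hj
    have hd : dist (x i) (x j) = 1 := ((mem_contactNeighbors x).1 hj').2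
    obtain ⟨k', a', b', hk'⟩ := hg j (hnb j hj')
    have hL : g.toRealAffineIsometryEquiv.linearIsometryEquiv (x j - x i) = g (x j) - g (x i) := by
      have := g.toRealAffineIsometryEquiv.map_vsub (x j) (x i)
      simpa [vsub_eq_sub] using this
    apply kissingShell_barlowStacking_subset_layerShell hσ k a b
    refine ⟨⟨k', a', b', ?_⟩, ?_⟩
    · rw [map_smul, hL, smul_sub, ← two_smul_barlowPos, ← two_smul_barlowPos, ← hk, ← hk']
      abel
    · rw [LinearIsometryEquiv.norm_map, norm_smul, Real.norm_two, ← dist_eq_norm, dist_comm, hd,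
        mul_one]

/-! ### The junction lies in no Barlow stacking -/

/-- The shell vectors of `twinConfig` in integer coordinates: `t ↦ 2 • (t/√18)`. -/
def twinShellMap (v : Fin 3 → ℤ) : EuclideanSpace ℝ (Fin 3) :=
  (2 : ℝ) • ((Real.sqrt ((18 : ℕ) : ℝ))⁻¹ • intVec v)

/-- `twinShellMap i` (`L ∘ intVec`, up to the factor `1/√18`) is injective. -/
theorem twinShellMap_injective : Function.Injective twinShellMap := by
  intro v w h
  have h18 : (Real.sqrt ((18 : ℕ) : ℝ))⁻¹ ≠ 0 := by positivity
  exact intVec_injective (smul_right_injective _ h18 (smul_right_injective _ two_ne_zero h))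

/-- `twinShellMap` is odd. -/
theorem neg_twinShellMap (v : Fin 3 → ℤ) : -twinShellMap v = twinShellMap (-v) := by
  simp [twinShellMap, intVec_neg, smul_neg]

/-- The contact shell of ball `0`: image of `hcpInt` under `q ↦ (1/√18) • intVec (3q)`. -/
theorem contactShell_twinConfig_zero_int :
    contactShell twinConfig 0 = twinShellMap '' (hcpInt : Set (Fin 3 → ℤ)) := by
  rw [twinConfig, contactShell_intConfig _ (by norm_num), image_shell_twinInt_zero]
  rfl

/-- The contact shell of ball `2`: image of `hcpInt` under `q ↦ (1/√18) • (flip of 3q)`. -/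
theorem contactShell_twinConfig_two_int :
    contactShell twinConfig 2 =
      twinShellMap '' ((hcpInt.image flipInt : Finset (Fin 3 → ℤ)) : Set (Fin 3 → ℤ)) := by
  rw [twinConfig, contactShell_intConfig _ (by norm_num), image_shell_twinInt_two]
  rfl

/-- Ball `0` has exactly twelve contacts. -/
theorem ncard_contactShell_twinConfig_zero : (contactShell twinConfig 0).ncard = 12 := by
  rw [contactShell_twinConfig_zero_int, Set.ncard_image_of_injective _ twinShellMap_injective,
    Set.ncard_coe_finset, card_hcpInt]

/-- Ball `2` has exactly twelve contacts. -/
theorem ncard_contactShell_twinConfig_two : (contactShell twinConfig 2).ncard = 12 := by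
  rw [contactShell_twinConfig_two_int, Set.ncard_image_of_injective _ twinShellMap_injective,
    Set.ncard_coe_finset]
  decide

/-- An anticuboctahedral shell is not centrally symmetric (ball `0`: the cap vector `(3,3,0)`). -/
theorem not_symmetric_contactShell_twinConfig_zero :
    ∃ s ∈ contactShell twinConfig 0, -s ∉ contactShell twinConfig 0 := by
  refine ⟨twinShellMap ![3, 3, 0], ?_, ?_⟩
  · rw [contactShell_twinConfig_zero_int]; exact ⟨_, by decide, rfl⟩
  · rw [contactShell_twinConfig_zero_int, neg_twinShellMap, twinShellMap_injective.mem_set_image]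
    decide

/-- The same for ball `2`. -/
theorem not_symmetric_contactShell_twinConfig_two :
    ∃ s ∈ contactShell twinConfig 2, -s ∉ contactShell twinConfig 2 := by
  refine ⟨twinShellMap ![3, 3, 0], ?_, ?_⟩
  · rw [contactShell_twinConfig_two_int]; exact ⟨_, by decide, rfl⟩
  · rw [contactShell_twinConfig_two_int, neg_twinShellMap, twinShellMap_injective.mem_set_image]
    decide

/-- `0 ∈ withNeighbors twinConfig twinCluster`. -/
theorem mem_withNeighbors_twinCluster_zero : (0 : Fin 26) ∈ withNeighbors twinConfig twinCluster :=
  mem_union_left _ (by simp [twinCluster])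

/-- `2 ∈ withNeighbors twinConfig twinCluster`. -/
theorem mem_withNeighbors_twinCluster_two : (2 : Fin 26) ∈ withNeighbors twinConfig twinCluster :=
  mem_union_left _ (by simp [twinCluster])

/-- Contact neighbours of cluster members belong to `withNeighbors`. -/
theorem mem_withNeighbors_of_mem_contactNeighbors {i j : Fin 26} (hi : i ∈ twinCluster)
    (hj : j ∈ contactNeighbors twinConfig i) : j ∈ withNeighbors twinConfig twinCluster :=
  mem_union_right _ (mem_biUnion.2 ⟨i, hi, hj⟩)

/-- **Three horizontal images of `(3,−3,0)`, `(3,0,−3)`, `(3,0,3)` are too many**: they span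
`ℝ³`, so the (surjective) linear isometry would map `ℝ³` into the horizontal plane. -/
theorem false_of_apply_two_eq_zero
    (L : EuclideanSpace ℝ (Fin 3) ≃ₗᵢ[ℝ] EuclideanSpace ℝ (Fin 3))
    (h₁ : (L (intVec ![3, -3, 0])) 2 = 0) (h₂ : (L (intVec ![3, 0, -3])) 2 = 0)
    (h₃ : (L (intVec ![3, 0, 3])) 2 = 0) : False := by
  set u : EuclideanSpace ℝ (Fin 3) := L.symm (EuclideanSpace.single 2 1) with hu
  have hdecomp : (6 : ℝ) • u =
      (-2 * u 1) • intVec ![3, -3, 0] + (u 0 + u 1 - u 2) • intVec ![3, 0, -3] +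
        (u 0 + u 1 + u 2) • intVec ![3, 0, 3] := by
    ext j
    fin_cases j <;> simp <;> ring
  have h6 : (6 : ℝ) * (L u) 2 = 0 := by
    have := congrArg (fun z : EuclideanSpace ℝ (Fin 3) => (L z) 2) hdecomp
    simp only [map_smul, map_add, PiLp.smul_apply, PiLp.add_apply, smul_eq_mul] at this
    rw [this, h₁, h₂, h₃]; ring
  have hLu : L u = EuclideanSpace.single 2 1 := by simp [hu]
  rw [hLu] at h6
  simp at h6

/-- **The closed neighbourhood of the twin junction is a fragment of NO Barlow stacking.** -/
theorem not_isBarlowFragmentOn_twinConfig :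
    ¬ IsBarlowFragmentOn twinConfig (withNeighbors twinConfig twinCluster) := by
  rintro ⟨σ, hσ, g, hg⟩
  have h18 : (Real.sqrt ((18 : ℕ) : ℝ))⁻¹ ≠ 0 := by positivity
  -- ball 0 (anticuboctahedron, axis (1,1,1))
  obtain ⟨α, β, hα, hβ, hsub⟩ := image_contactShell_subset_layerShell hσ g hg
    mem_withNeighbors_twinCluster_zero
    (fun j hj => mem_withNeighbors_of_mem_contactNeighbors (by simp [twinCluster]) hj)
  have hor0 : ∀ t ∈ hcpInt, -t ∈ hcpInt →
      (g.toRealAffineIsometryEquiv.linearIsometryEquiv (intVec t)) 2 = 0 := by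
    intro t ht hnt
    have hs : twinShellMap t ∈ contactShell twinConfig 0 := by
      rw [contactShell_twinConfig_zero_int]; exact ⟨t, ht, rfl⟩
    have hns : -twinShellMap t ∈ contactShell twinConfig 0 := by
      rw [contactShell_twinConfig_zero_int, neg_twinShellMap]; exact ⟨-t, hnt, rfl⟩
    have := apply_two_eq_zero_of_shell _ hα hβ hsub ncard_contactShell_twinConfig_zero
      not_symmetric_contactShell_twinConfig_zero hs hns
    simpa [twinShellMap, map_smul, h18] using this
  -- ball 2 (anticuboctahedron, axis (1,1,-1))
  obtain ⟨α', β', hα', hβ', hsub'⟩ := image_contactShell_subset_layerShell hσ g hg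
    mem_withNeighbors_twinCluster_two
    (fun j hj => mem_withNeighbors_of_mem_contactNeighbors (by simp [twinCluster]) hj)
  have hor2 : ∀ t ∈ hcpInt, -t ∈ hcpInt →
      (g.toRealAffineIsometryEquiv.linearIsometryEquiv (intVec (flipInt t))) 2 = 0 := by
    intro t ht hnt
    have hflip : flipInt (-t) = -flipInt t := by
      ext j; fin_cases j <;> simp [flipInt]
    have hs : twinShellMap (flipInt t) ∈ contactShell twinConfig 2 := by
      rw [contactShell_twinConfig_two_int]
      exact ⟨flipInt t, by simpa using Finset.mem_image_of_mem flipInt ht, rfl⟩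
    have hns : -twinShellMap (flipInt t) ∈ contactShell twinConfig 2 := by
      rw [contactShell_twinConfig_two_int, neg_twinShellMap, ← hflip]
      exact ⟨flipInt (-t), by simpa using Finset.mem_image_of_mem flipInt hnt, rfl⟩
    have := apply_two_eq_zero_of_shell _ hα' hβ' hsub' ncard_contactShell_twinConfig_two
      not_symmetric_contactShell_twinConfig_two hs hns
    simpa [twinShellMap, map_smul, h18] using this
  have hf : flipInt ![3, 0, -3] = ![3, 0, 3] := by decide
  exact false_of_apply_two_eq_zero _ (hor0 _ (by decide) (by decide))
    (hor0 _ (by decide) (by decide)) (hf ▸ hor2 ![3, 0, -3] (by decide) (by decide))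

/-- **`SmallTwinWitness` holds** — discharged by the explicit 26-ball junction. -/
theorem smallTwinWitness : SmallTwinWitness :=
  ⟨26, twinConfig, twinCluster, isUnitPacking_twinConfig, ⟨0, by simp [twinCluster]⟩,
    isContactConnected_twinCluster, isClosePackedShell_of_mem_twinCluster,
    not_isBarlowFragmentOn_twinConfig⟩

/-- **W-2G is false: close-packed first shells do not force a common Barlow stacking.** -/
theorem not_naiveGrainRigidity : ¬ NaiveGrainRigidity :=
  not_naiveGrainRigidity_of_smallTwinWitness smallTwinWitness

end PartB

end Summit.Ventures.Crystal3D

end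

#print axioms Summit.Ventures.Crystal3D.not_isBarlowFragmentOn_twinConfig
#print axioms Summit.Ventures.Crystal3D.smallTwinWitness
#print axioms Summit.Ventures.Crystal3D.not_naiveGrainRigidity
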